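/-
PRIME-WINDOW BLINDNESS — the K-task kernel `PrimeWindowBlindModel` PROVED (cell rh-split, L53; director-rh g12
(AZ1)/(BA1)(ii) 2026-08-28; spec rh-idea-4 g3 `pub/ideators/rh-idea-4/pwb/LINE-PrimeWindowBlindness.md` §2a
(d5aed3d687ebafee); critic idea-crit-1 g2 VERDICT 02:41:23Z §(4) «plan sound on paper»).  Part 2 of 2 (part 1 =
`PrimeWindowFootprint.lean`); sequel of `PrimeWindowBlindnessClass.lean`, whose class-form theorems become
unconditional here.  Typed by rh-split-typer-3 g5.  Nothing here bears on the truth of RH.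
-/
import Summits.RiemannHypothesis.RiemannHypothesis.Theorems.Splittings.PrimeWindowBlindnessClass
import Summits.RiemannHypothesis.RiemannHypothesis.Theorems.Splittings.PrimeWindowFootprint
import HarnessLib

/-!
# The thin blind model with a prescribed prime-window footprint (B26 re-run with dilated aliases)

`exists_tower_thin_blind_model_window`: for every `h > 0`, `σ* > 0`, `e > 0`, depth `0 < c ≤ 1/(⌈4/e⌉₊ + 3)`,
window half-width `U` and budget `ε > 0` there is a configuration of zero quadruples satisfying VERBATIM the twelve
clauses of `ScrewLatticeTowerThin.exists_tower_thin_blind_model` (part D's eleven; (E1) multiplicity band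
`[1, B]`; (E2) thin ordinate count `≤ C T^e`) AND `|Ψ_Z(t)| ≤ ε` for all `|t| ≤ U` (the PRIME-WINDOW FOOTPRINT;
vacuous for `U < 0`).  PROOF = the proof of `exists_tower_thin_blind_model` with the weight-adapted aliases
DILATED, `N_i = N₀ + ⌈M/√α_i⌉₊` (tree: `N₀ + ⌈1/√α_i⌉₊`), so that `ScrewLatticeTowerBand.alias_window` and
`sq_window_lower` apply verbatim with `s = √α_i/M` and give `4π²M²/h² ≤ α_i γ_i² ≤ M² U₀²`; the ONE global scale
becomes `λ = 3h²/(4π²M²)` (tree: `3h²/(4π²)`), keeping the multiplicity band `λαγ²/3 ≤ m ≤ 3λαγ²` inside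
`[1, 3λM²U₀²]`; floor/ceiling constant `A = λ Σα` and `LPSD(h)` from part C's lattice theorems by name (the band
clause is `∃ A > 0`, so the `1/M²` rescaling is admissible — critic §(4)); the thin count only improves
(`α γ² ≥ 4π²M²/h² ≥ 4π²/h²`); the footprint is `sup_{|t| ≤ U} |Ψ_Z(t)| ≤ 8 e^{σ*U} Σ_i (m₁/γ₁² + m₂/γ₂²) ≤
48 e^{σ*U} λ Σα ≤ ε` for `M ≥ 36 h² e^{σ*U} Σα/(π² ε)` (part 1: `abs_modelPsi_le_window`, `footprint_budget`).
COROLLARIES (§20): `primeWindowBlindModel_holds : PrimeWindowBlindModel`, and the class form made unconditional —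
`classCP_blind_to_tower'`, `not_criterion_of_classCP'`.  HONEST LABEL: a blind model is an obstruction statement
about instruments (one-lattice class-C screw data ∧ the true `Λ(n)`, `n ≤ e^U`, read at precision `ε > 0`),
RH-free, ζ-free; (s)/(b)-record material, not a crux toward RH; std axioms.  Nothing here bears on the truth of RH.
-/

noncomputable section

set_option linter.dupNamespace false

open Complex Set Filter Topology
open scoped ComplexConjugate Real

namespace Summit.RiemannHypothesis.RiemannHypothesis.Theorems.Splittings.ScrewLatticeTower

open Summit.RiemannHypothesis.RiemannHypothesis.Theorems.Splittings.ScrewLatticeWolff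
open Summit.RiemannHypothesis.RiemannHypothesis.Theorems.Splittings.ScrewLatticeWolffModel

/-! ## 19. The thin blind model with window footprint `≤ ε` -/

/-- **B26 re-run with dilated aliases (kernel of PRIME-WINDOW BLINDNESS).**  For every `h > 0`, `σ* > 0`,
every `e > 0`, every depth `0 < c ≤ 1/(⌈4/e⌉₊ + 3)`, every window half-width `U` and every budget `ε > 0` there
is a positive-real-weight configuration of zero quadruples satisfying, VERBATIM, the twelve clauses of
`ScrewLatticeTowerThin.exists_tower_thin_blind_model` (part D's eleven clauses, (E1) the multiplicity band
`1 ≤ m ≤ B`, (E2) the thin ordinate count `≤ C T^e` for `T ≥ 1`) AND the PRIME-WINDOW FOOTPRINT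
`|Ψ_Z(t)| ≤ ε` for every `|t| ≤ U`.  Built on the tower data of `ScrewLatticeTowerE.exists_towerData_thin`
(exponent `β = ⌈4/e⌉₊`) with the DILATED weight-adapted aliases `N_i = N₀ + ⌈M/√α_i⌉₊` and the scale
`λ = 3h²/(4π²M²)`, `M = ⌈36 h² e^{σ*U} Σα/(π² ε)⌉₊ + 1`.  (Rider r1, theory-1 25.11: the footprint bound alone is
the classical invisibility of high zeros below `X`; the content is its SIMULTANEITY with B26's lattice clauses under
the `M`-dilation.)  HONEST LABEL: a blind model is an obstruction statement about instruments (lattice class-C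
data ∧ the prime window read at precision `ε`), RH-free; nothing here bears on the truth of RH. -/
theorem exists_tower_thin_blind_model_window {h σs c e : ℝ} (U : ℝ) {ε : ℝ} (hh : 0 < h) (hσs : 0 < σs)
    (hc : 0 < c) (he : 0 < e) (hce : c ≤ 1 / ((⌈4 / e⌉₊ : ℕ) + 3 : ℝ)) (hε : 0 < ε) :
    ∃ (ι : Type) (m₁ m₂ : ι → ℝ) (κ₁ κ₂ : ι → ℂ),
      (Nonempty ι ∧
      (∀ i, 0 < m₁ i ∧ 0 < m₂ i) ∧
      (∀ i, 0 < (κ₁ i).re ∧ (κ₁ i).re < σs ∧ (κ₂ i).re = (κ₁ i).re) ∧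
      (∀ i, 14 < (κ₁ i).im ∧ 14 < (κ₂ i).im) ∧
      (∀ T : ℝ, {i | (κ₁ i).im ≤ T}.Finite ∧ {i | (κ₂ i).im ≤ T}.Finite) ∧
      Summable (fun i ↦ m₁ i / (κ₁ i).im ^ 2 + m₂ i / (κ₂ i).im ^ 2) ∧
      (∀ i, ∃ j, (κ₁ i).re < (κ₁ j).re) ∧
      (∃ A : ℝ, 0 < A ∧ ∀ k : ℕ, 1 ≤ k →
          2 * A ≤ modelPsi m₁ m₂ κ₁ κ₂ (k * h) ∧ modelPsi m₁ m₂ κ₁ κ₂ (k * h) ≤ 6 * A) ∧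
      (∀ (N : ℕ) (t x : Fin N → ℝ), (∀ a, t a ∈ Set.range fun k : ℕ ↦ (k : ℝ) * h) →
          0 ≤ ∑ a, ∑ b, (modelPsi m₁ m₂ κ₁ κ₂ (t a) + modelPsi m₁ m₂ κ₁ κ₂ (t b)
            - modelPsi m₁ m₂ κ₁ κ₂ (t a - t b)) * (x a * x b)) ∧
      (∀ σ < σs, {i | (κ₁ i).re ≤ σ}.Finite) ∧
      (∃ B : ℝ, ∀ i, 1 ≤ m₁ i ∧ m₁ i ≤ B ∧ 1 ≤ m₂ i ∧ m₂ i ≤ B) ∧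
      (∃ C : ℝ, ∀ T : ℝ, 1 ≤ T → ∃ s : Finset ι,
          (∀ i, (κ₁ i).im ≤ T ∨ (κ₂ i).im ≤ T → i ∈ s) ∧ (s.card : ℝ) ≤ C * T ^ e)) ∧
      (∀ t : ℝ, |t| ≤ U → |modelPsi m₁ m₂ κ₁ κ₂ t| ≤ ε) := by
  have hh0 : h ≠ 0 := hh.ne'
  have hπ := Real.pi_pos
  set β : ℕ := ⌈4 / e⌉₊ with hβ_def
  have hβe : 4 / e ≤ (β : ℝ) := Nat.le_ceil _
  obtain ⟨hx, hy⟩ := depth_hyps hc β (by simpa using hce)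
  have hR : 1 < Real.exp (σs * h) := Real.one_lt_exp_iff.mpr (by positivity)
  obtain ⟨ι, -, w, α, ℓ, K, E, hne, hann, hα0, hαs, hW, hsup, hdisc, hthin, hcount⟩ :=
    exists_towerData_thin hR hc hx β hy
  have hαle : ∀ i, α i ≤ ∑' j, α j := fun i ↦ hαs.le_tsum i (fun j _ ↦ (hα0 j).le)
  have hα0' : ∀ i, 0 ≤ α i := fun i ↦ (hα0 i).le
  set S : ℝ := max 1 (∑' j, α j) with hS_def
  have hS1 : 1 ≤ S := le_max_left _ _
  have hsq0 : ∀ i, 0 < Real.sqrt (α i) := fun i ↦ Real.sqrt_pos.mpr (hα0 i)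
  have hsq2 : ∀ i, Real.sqrt (α i) ^ 2 = α i := fun i ↦ Real.sq_sqrt (hα0 i).le
  have hsqS : ∀ i, Real.sqrt (α i) ≤ S := by
    intro i
    rcases le_or_gt (α i) 1 with h1 | h1
    · calc Real.sqrt (α i) ≤ Real.sqrt 1 := Real.sqrt_le_sqrt h1
        _ = 1 := Real.sqrt_one
        _ ≤ S := hS1
    · have h2 : Real.sqrt (α i) ≤ α i :=
        calc Real.sqrt (α i) ≤ Real.sqrt (α i ^ 2) := Real.sqrt_le_sqrt (le_self_pow₀ h1.le two_ne_zero)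
          _ = α i := Real.sqrt_sq (hα0 i).le
      exact h2.trans ((hαle i).trans (le_max_right _ _))
  -- the DILATION parameter `M ≥ 1`, `M ≥ Q = 36 h² e^{σ* U} Σα/(π² ε)`
  set Q : ℝ := 36 * h ^ 2 * Real.exp (σs * U) * (∑' j, α j) / (π ^ 2 * ε) with hQ_def
  set M : ℕ := ⌈Q⌉₊ + 1 with hM_def
  have hMQ : Q ≤ (M : ℝ) := by
    rw [hM_def]; push_cast; linarith only [Nat.le_ceil Q]
  have hM1 : (1 : ℝ) ≤ M := by
    rw [hM_def]; push_cast; linarith only [(Nat.cast_nonneg _ : (0 : ℝ) ≤ (⌈Q⌉₊ : ℝ))]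
  have hM0 : (0 : ℝ) < M := one_pos.trans_le hM1
  have hMQ2 : Q ≤ (M : ℝ) ^ 2 := hMQ.trans (le_self_pow₀ hM1 two_ne_zero)
  -- weight-adapted DILATED aliases `N_i = N₀ + ⌈M/√α_i⌉` (read `s_i = √α_i / M`)
  set N₀ : ℕ := ⌈(14 * h + 2 * σs * h + π) / (2 * π)⌉₊ + 1 with hN₀
  have hN₀ge : (14 * h + 2 * σs * h + π) / (2 * π) + 1 ≤ (N₀ : ℝ) := by
    rw [hN₀]; push_cast; linarith only [Nat.le_ceil ((14 * h + 2 * σs * h + π) / (2 * π))]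
  have hN₀2 : (2 : ℝ) ≤ N₀ := by
    have hpos : 0 < (14 * h + 2 * σs * h + π) / (2 * π) := by positivity
    have h1 : 1 ≤ ⌈(14 * h + 2 * σs * h + π) / (2 * π)⌉₊ := Nat.one_le_iff_ne_zero.mpr
      (by rw [Ne, Nat.ceil_eq_zero, not_le]; exact hpos)
    rw [hN₀]; push_cast
    have : (1 : ℝ) ≤ (⌈(14 * h + 2 * σs * h + π) / (2 * π)⌉₊ : ℝ) := by exact_mod_cast h1
    linarith only [this]
  set sM : ι → ℝ := fun i ↦ Real.sqrt (α i) / M with hsM_def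
  have hsM0 : ∀ i, 0 < sM i := fun i ↦ div_pos (hsq0 i) hM0
  have hsM2 : ∀ i, sM i ^ 2 * (M : ℝ) ^ 2 = α i := by
    intro i; rw [hsM_def]; simp only; rw [div_pow, hsq2 i, div_mul_cancel₀ _ (pow_ne_zero 2 hM0.ne')]
  have hsMS : ∀ i, sM i ≤ S := fun i ↦
    (div_le_self (hsq0 i).le hM1).trans (hsqS i)
  set Nf : ι → ℕ := fun i ↦ N₀ + ⌈1 / sM i⌉₊ with hNf
  have hNfge : ∀ i, (N₀ : ℝ) + 1 / sM i ≤ (Nf i : ℕ) := by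
    intro i; rw [hNf]; push_cast; linarith only [Nat.le_ceil (1 / sM i)]
  have hNfle : ∀ i, ((Nf i : ℕ) : ℝ) ≤ N₀ + 1 / sM i + 1 := by
    intro i; rw [hNf]; push_cast
    linarith only [(Nat.ceil_lt_add_one (by positivity : (0 : ℝ) ≤ 1 / sM i)).le]
  have hwin : ∀ i, 2 * π / (h * sM i) ≤ (2 * π * (Nf i : ℕ) - π) / h ∧
      (2 * π * (Nf i : ℕ) + π) / h ≤ 2 * ((2 * π * (Nf i : ℕ) - π) / h) ∧
      sM i * ((2 * π * (Nf i : ℕ) + π) / h) ≤ (2 * π + (2 * N₀ + 3) * π * sM i) / h :=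
    fun i ↦ alias_window hh (hsM0 i) hN₀2 (hNfge i) (hNfle i)
  set σ : ι → ℝ := fun i ↦ Real.log ‖w i‖ / h with hσ_def
  set γ₁ : ι → ℝ := fun i ↦ (arg (w i) + 2 * π * (Nf i : ℕ)) / h with hγ₁_def
  set γ₂ : ι → ℝ := fun i ↦ (2 * π * (Nf i : ℕ) - arg (w i)) / h with hγ₂_def
  set κ₁ : ι → ℂ := fun i ↦ ((σ i : ℝ) : ℂ) + ((γ₁ i : ℝ) : ℂ) * I with hκ₁_def
  set κ₂ : ι → ℂ := fun i ↦ ((σ i : ℝ) : ℂ) + ((γ₂ i : ℝ) : ℂ) * I with hκ₂_def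
  have hw0 : ∀ i, w i ≠ 0 := fun i ↦ by
    intro h0; have := (hann i).1; rw [h0, norm_zero] at this; exact absurd this (by norm_num)
  have hσpos : ∀ i, 0 < σ i := fun i ↦ div_pos (Real.log_pos (hann i).1) hh
  have hσlt : ∀ i, σ i < σs := fun i ↦ by
    rw [hσ_def]
    simp only
    rw [div_lt_iff₀ hh]
    exact (Real.log_lt_iff_lt_exp (norm_pos_iff.mpr (hw0 i))).mpr (hann i).2
  have hNlow : ∀ i, 14 * h + 2 * σs * h + π ≤ 2 * π * (Nf i : ℕ) - 2 * π := by
    intro i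
    have h0 : 0 ≤ 1 / sM i := by positivity
    have h1 : (N₀ : ℝ) ≤ (Nf i : ℕ) := by linarith only [hNfge i, h0]
    have h2 : (14 * h + 2 * σs * h + π) / (2 * π) ≤ (Nf i : ℕ) - 1 := by linarith only [hN₀ge, h1]
    rw [div_le_iff₀ (by positivity)] at h2
    linarith only [h2]
  have hγ₁low : ∀ i, 14 + 2 * σs < γ₁ i := by
    intro i
    rw [hγ₁_def]; simp only; rw [lt_div_iff₀ hh]
    linarith only [hNlow i, Complex.neg_pi_lt_arg (w i), hπ]
  have hγ₂low : ∀ i, 14 + 2 * σs < γ₂ i := by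
    intro i
    rw [hγ₂_def]; simp only; rw [lt_div_iff₀ hh]
    linarith only [hNlow i, Complex.arg_le_pi (w i), hπ]
  have h14 : (0 : ℝ) < 14 + 2 * σs := by positivity
  have hγ₁pos : ∀ i, 0 < γ₁ i := fun i ↦ h14.trans (hγ₁low i)
  have hγ₂pos : ∀ i, 0 < γ₂ i := fun i ↦ h14.trans (hγ₂low i)
  -- both ordinates lie in the alias window `[(2π N_i - π)/h, (2π N_i + π)/h]`
  have hγ₁lo : ∀ i, (2 * π * (Nf i : ℕ) - π) / h ≤ γ₁ i := fun i ↦ by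
    rw [hγ₁_def]; simp only
    exact div_le_div_of_nonneg_right (by linarith only [Complex.neg_pi_lt_arg (w i)]) hh.le
  have hγ₂lo : ∀ i, (2 * π * (Nf i : ℕ) - π) / h ≤ γ₂ i := fun i ↦ by
    rw [hγ₂_def]; simp only
    exact div_le_div_of_nonneg_right (by linarith only [Complex.arg_le_pi (w i)]) hh.le
  have hγ₁hi : ∀ i, γ₁ i ≤ (2 * π * (Nf i : ℕ) + π) / h := fun i ↦ by
    rw [hγ₁_def]; simp only
    exact div_le_div_of_nonneg_right (by linarith only [Complex.arg_le_pi (w i)]) hh.le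
  have hγ₂hi : ∀ i, γ₂ i ≤ (2 * π * (Nf i : ℕ) + π) / h := fun i ↦ by
    rw [hγ₂_def]; simp only
    exact div_le_div_of_nonneg_right (by linarith only [Complex.neg_pi_lt_arg (w i)]) hh.le
  -- the weight controls the ordinate: `4π²M²/h² ≤ α γ² ≤ (M U₀)²` on the window
  set U₀ : ℝ := (2 * π + (2 * N₀ + 3) * π * S) / h with hU₀
  have hlow_sq : ∀ (i) (γ : ℝ), (2 * π * (Nf i : ℕ) - π) / h ≤ γ →
      4 * π ^ 2 * (M : ℝ) ^ 2 / h ^ 2 ≤ α i * γ ^ 2 := by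
    intro i γ hγ
    have h1 := sq_window_lower hh (hsM0 i) ((hwin i).1.trans hγ)
    have h2 := mul_le_mul_of_nonneg_right h1 (sq_nonneg (M : ℝ))
    calc 4 * π ^ 2 * (M : ℝ) ^ 2 / h ^ 2 = 4 * π ^ 2 / h ^ 2 * (M : ℝ) ^ 2 := by ring
      _ ≤ sM i ^ 2 * γ ^ 2 * (M : ℝ) ^ 2 := h2
      _ = α i * γ ^ 2 := by rw [← hsM2 i]; ring
  have hlow_sq' : ∀ (i) (γ : ℝ), (2 * π * (Nf i : ℕ) - π) / h ≤ γ → 4 * π ^ 2 / h ^ 2 ≤ α i * γ ^ 2 := by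
    intro i γ hγ
    refine le_trans ?_ (hlow_sq i γ hγ)
    have h0 : 0 ≤ 4 * π ^ 2 / h ^ 2 := by positivity
    calc 4 * π ^ 2 / h ^ 2 = 4 * π ^ 2 / h ^ 2 * 1 := (mul_one _).symm
      _ ≤ 4 * π ^ 2 / h ^ 2 * (M : ℝ) ^ 2 := mul_le_mul_of_nonneg_left (one_le_pow₀ hM1) h0
      _ = 4 * π ^ 2 * (M : ℝ) ^ 2 / h ^ 2 := by ring
  have hup_sq : ∀ (i) (γ : ℝ), 0 ≤ γ → γ ≤ (2 * π * (Nf i : ℕ) + π) / h →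
      α i * γ ^ 2 ≤ ((M : ℝ) * U₀) ^ 2 := by
    intro i γ hγ0 hγ
    have h1 : sM i * γ ≤ U₀ := by
      refine (mul_le_mul_of_nonneg_left hγ (hsM0 i).le).trans ((hwin i).2.2.trans ?_)
      rw [hU₀]
      apply div_le_div_of_nonneg_right _ hh.le
      have : (2 * N₀ + 3) * π * sM i ≤ (2 * N₀ + 3) * π * S :=
        mul_le_mul_of_nonneg_left (hsMS i) (by positivity)
      linarith only [this]
    have h2 : Real.sqrt (α i) * γ ≤ (M : ℝ) * U₀ := by
      have : Real.sqrt (α i) * γ = (M : ℝ) * (sM i * γ) := by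
        rw [hsM_def]; simp only; rw [← mul_assoc, mul_div_cancel₀ _ hM0.ne']
      rw [this]
      exact mul_le_mul_of_nonneg_left h1 hM0.le
    have h3 := pow_le_pow_left₀ (by positivity) h2 2
    rw [mul_pow, hsq2 i] at h3
    exact h3
  -- tuning with the ONE global scale `λ = 3h²/(4π²M²)`
  set lam : ℝ := 3 * h ^ 2 / (4 * π ^ 2 * (M : ℝ) ^ 2) with hlam
  have hlam0 : 0 < lam := by positivity
  have hlam3 : lam * (4 * π ^ 2 * (M : ℝ) ^ 2 / h ^ 2) = 3 := by
    rw [hlam]; field_simp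
  have htun : ∀ i, ∃ m₁ m₂ : ℝ, 0 < m₁ ∧ 0 < m₂ ∧
      (m₁ : ℂ) / ((σ i : ℂ) + γ₁ i * I) ^ 2 + (m₂ : ℂ) / (conj ((σ i : ℂ) + γ₂ i * I)) ^ 2
        = -((lam * α i : ℝ) : ℂ) ∧
      m₁ / γ₁ i ^ 2 ≤ 3 * (lam * α i) ∧ m₂ / γ₂ i ^ 2 ≤ 3 * (lam * α i) ∧
      lam * α i * γ₁ i ^ 2 ≤ 3 * m₁ ∧ lam * α i * γ₂ i ^ 2 ≤ 3 * m₂ := fun i ↦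
    exists_tuning_band (hσpos i) (by linarith only [hσlt i, hγ₁low i])
      (by linarith only [hσlt i, hγ₂low i])
      ((hγ₂hi i).trans ((hwin i).2.1.trans (by linarith only [hγ₁lo i])))
      ((hγ₁hi i).trans ((hwin i).2.1.trans (by linarith only [hγ₂lo i])))
      (mul_pos hlam0 (hα0 i))
  choose m₁ m₂ hm₁ hm₂ htune hb₁ hb₂ hl₁ hl₂ using htun
  have hw₁ : ∀ i, Complex.exp (κ₁ i * h) = w i := fun i ↦ exp_kappa₁ (hw0 i) hh0 (Nf i)
  have hw₂ : ∀ i, Complex.exp (κ₂ i * h) = conj (w i) := fun i ↦ exp_kappa₂ (hw0 i) hh0 (Nf i)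
  have htune' : ∀ i, (m₁ i : ℂ) / κ₁ i ^ 2 + (m₂ i : ℂ) / (conj (κ₂ i)) ^ 2
      = -(((lam * α i : ℝ)) : ℂ) := fun i ↦ htune i
  have hw1 : ∀ i, 1 ≤ ‖w i‖ := fun i ↦ (hann i).1.le
  have hκ₁re : ∀ i, (κ₁ i).re = σ i := fun i ↦ by
    simp only [hκ₁_def, Complex.add_re, Complex.ofReal_re, Complex.mul_re, Complex.I_re, Complex.I_im,
      Complex.ofReal_im, mul_zero, mul_one, sub_zero, add_zero]
  have hκ₂re : ∀ i, (κ₂ i).re = σ i := fun i ↦ by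
    simp only [hκ₂_def, Complex.add_re, Complex.ofReal_re, Complex.mul_re, Complex.I_re, Complex.I_im,
      Complex.ofReal_im, mul_zero, mul_one, sub_zero, add_zero]
  have hκ₁im : ∀ i, (κ₁ i).im = γ₁ i := fun i ↦ by
    simp only [hκ₁_def, Complex.add_im, Complex.ofReal_im, Complex.mul_im, Complex.ofReal_re, Complex.I_im,
      Complex.I_re, mul_one, mul_zero, zero_add, add_zero]
  have hκ₂im : ∀ i, (κ₂ i).im = γ₂ i := fun i ↦ by
    simp only [hκ₂_def, Complex.add_im, Complex.ofReal_im, Complex.mul_im, Complex.ofReal_re, Complex.I_im,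
      Complex.I_re, mul_one, mul_zero, zero_add, add_zero]
  have hs6 : Summable (fun i ↦ 6 * (lam * α i)) := (hαs.mul_left lam).mul_left 6
  have hterm0 : ∀ i, 0 ≤ m₁ i / (κ₁ i).im ^ 2 + m₂ i / (κ₂ i).im ^ 2 := fun i ↦ by
    have := hm₁ i; have := hm₂ i
    rw [hκ₁im, hκ₂im]; positivity
  have hterm6 : ∀ i, m₁ i / (κ₁ i).im ^ 2 + m₂ i / (κ₂ i).im ^ 2 ≤ 6 * (lam * α i) := fun i ↦ by
    rw [hκ₁im, hκ₂im]; linarith only [hb₁ i, hb₂ i]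
  have hsumm : Summable (fun i ↦ m₁ i / (κ₁ i).im ^ 2 + m₂ i / (κ₂ i).im ^ 2) :=
    Summable.of_nonneg_of_le hterm0 hterm6 hs6
  have htsum6 : ∑' i, (m₁ i / (κ₁ i).im ^ 2 + m₂ i / (κ₂ i).im ^ 2) ≤ 6 * (lam * ∑' i, α i) := by
    calc ∑' i, (m₁ i / (κ₁ i).im ^ 2 + m₂ i / (κ₂ i).im ^ 2) ≤ ∑' i, 6 * (lam * α i) :=
          Summable.tsum_le_tsum hterm6 hsumm hs6
      _ = 6 * (lam * ∑' i, α i) := by rw [tsum_mul_left, tsum_mul_left]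
  -- (E2) the count at every height `T ≥ 1`: `γ ≤ T ⇒ α ≥ 4π²/(h²T²) ⇒ ℓ ≤ L(T)`, then `count_algebra`
  have ha₀ : 0 < 4 * π ^ 2 / h ^ 2 := by positivity
  have hD0 : 0 ≤ E / (4 * π ^ 2 / h ^ 2) := by
    obtain ⟨i₀⟩ := hne
    have hE0 : 0 ≤ E := le_trans (by have := hα0 i₀; positivity) (hthin i₀)
    positivity
  have hcountT : ∀ T : ℝ, 1 ≤ T → ∃ s : Finset ι, (∀ i, γ₁ i ≤ T ∨ γ₂ i ≤ T → i ∈ s) ∧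
      (s.card : ℝ) ≤ (K + ((E / (4 * π ^ 2 / h ^ 2)) ^ ((β + 1 : ℕ) : ℝ)⁻¹ + 1) ^ 2) * T ^ e := by
    intro T hT
    obtain ⟨s, hs, hcard⟩ := hcount ⌊(E / (4 * π ^ 2 / h ^ 2) * T ^ 2) ^ ((β + 1 : ℕ) : ℝ)⁻¹⌋₊
    refine ⟨s, fun i hi ↦ hs i (nat_le_floor_rpow ha₀ (hthin i) ?_),
      count_algebra hD0 hT he hβe (Nat.floor_le (by positivity)) hcard⟩
    rcases hi with hi | hi
    · exact (hlow_sq' i (γ₁ i) (hγ₁lo i)).trans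
        (mul_le_mul_of_nonneg_left (pow_le_pow_left₀ (hγ₁pos i).le hi 2) (hα0' i))
    · exact (hlow_sq' i (γ₂ i) (hγ₂lo i)).trans
        (mul_le_mul_of_nonneg_left (pow_le_pow_left₀ (hγ₂pos i).le hi 2) (hα0' i))
  refine ⟨ι, m₁, m₂, κ₁, κ₂, ⟨hne, fun i ↦ ⟨hm₁ i, hm₂ i⟩, ?_, ?_, ?_, hsumm, ?_, ?_, ?_, ?_, ?_, ?_⟩, ?_⟩
  · intro i
    rw [hκ₁re, hκ₂re]
    exact ⟨hσpos i, hσlt i, rfl⟩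
  · intro i
    rw [hκ₁im, hκ₂im]
    exact ⟨(lt_add_of_pos_right 14 (by positivity)).trans (hγ₁low i),
      (lt_add_of_pos_right 14 (by positivity)).trans (hγ₂low i)⟩
  · -- local finiteness, from the count at height `max T 1`
    intro T
    obtain ⟨s, hs, -⟩ := hcountT (max T 1) (le_max_right _ _)
    constructor
    · refine s.finite_toSet.subset fun i hi ↦ ?_
      have hi' : (κ₁ i).im ≤ T := hi
      rw [hκ₁im] at hi'
      exact hs i (Or.inl (hi'.trans (le_max_left _ _)))
    · refine s.finite_toSet.subset fun i hi ↦ ?_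
      have hi' : (κ₂ i).im ≤ T := hi
      rw [hκ₂im] at hi'
      exact hs i (Or.inr (hi'.trans (le_max_left _ _)))
  · -- sup not attained
    intro i
    obtain ⟨j, hlt⟩ := hsup i
    refine ⟨j, ?_⟩
    rw [hκ₁re, hκ₁re, hσ_def]
    exact div_lt_div_of_pos_right (Real.log_lt_log (norm_pos_iff.mpr (hw0 i)) hlt) hh
  · -- floor and ceiling with A = λ Σ α > 0
    refine ⟨lam * ∑' i, α i, ?_, fun k hk ↦ ⟨?_, ?_⟩⟩
    · obtain ⟨i₀⟩ := hne
      exact mul_pos hlam0 (hαs.tsum_pos hα0' i₀ (hα0 i₀))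
    · have := modelPsi_lattice_floor hw₁ hw₂ htune' hαs hα0' hw1 hlam0.le hW hk
      simpa only [mul_assoc] using this
    · have := modelPsi_lattice_ceiling hw₁ hw₂ htune' hαs hα0' hw1 hlam0.le hW hk
      simpa only [mul_assoc] using this
  · intro N t' x ht'
    exact modelPsi_latticePSD hw₁ hw₂ htune' hαs hα0' hw1 hlam0.le hW t' x ht'
  · -- discreteness of the abscissae below `σ*`
    intro σ' hσ'
    have hρ : Real.exp (σ' * h) < Real.exp (σs * h) := Real.exp_lt_exp.mpr (mul_lt_mul_of_pos_right hσ' hh)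
    refine (hdisc (Real.exp (σ' * h)) hρ).subset fun i hi ↦ ?_
    have hi' : (κ₁ i).re ≤ σ' := hi
    rw [hκ₁re, hσ_def] at hi'
    simp only [Set.mem_setOf_eq]
    have hi'' : Real.log ‖w i‖ / h ≤ σ' := hi'
    rw [div_le_iff₀ hh] at hi''
    exact (Real.log_le_iff_le_exp (norm_pos_iff.mpr (hw0 i))).mp hi''
  · -- (E1) the multiplicity band `1 ≤ m ≤ B`, `B = 3 λ (M U₀)²`, after the one scale `λ`
    refine ⟨3 * lam * ((M : ℝ) * U₀) ^ 2, fun i ↦ ⟨?_, ?_, ?_, ?_⟩⟩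
    · have h1 := mul_le_mul_of_nonneg_left (hlow_sq i (γ₁ i) (hγ₁lo i)) hlam0.le
      rw [hlam3] at h1
      linarith only [h1, hl₁ i]
    · have h1 := mul_le_mul_of_nonneg_left (hup_sq i (γ₁ i) (hγ₁pos i).le (hγ₁hi i)) hlam0.le
      have h2 := hb₁ i
      rw [div_le_iff₀ (pow_pos (hγ₁pos i) 2)] at h2
      linarith only [h1, h2]
    · have h1 := mul_le_mul_of_nonneg_left (hlow_sq i (γ₂ i) (hγ₂lo i)) hlam0.le
      rw [hlam3] at h1
      linarith only [h1, hl₂ i]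
    · have h1 := mul_le_mul_of_nonneg_left (hup_sq i (γ₂ i) (hγ₂pos i).le (hγ₂hi i)) hlam0.le
      have h2 := hb₂ i
      rw [div_le_iff₀ (pow_pos (hγ₂pos i) 2)] at h2
      linarith only [h1, h2]
  · -- (E2) the thin ordinate count for the union of both families
    refine ⟨K + ((E / (4 * π ^ 2 / h ^ 2)) ^ ((β + 1 : ℕ) : ℝ)⁻¹ + 1) ^ 2, fun T hT ↦ ?_⟩
    obtain ⟨s, hs, hcard⟩ := hcountT T hT
    refine ⟨s, fun i hi ↦ hs i ?_, hcard⟩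
    rw [hκ₁im, hκ₂im] at hi
    exact hi
  · -- the PRIME-WINDOW FOOTPRINT: `|Ψ_Z(t)| ≤ 8 e^{σ* U} Σ m/γ² ≤ 48 e^{σ* U} λ Σα ≤ ε` (`footprint_budget`)
    intro t ht
    have hre : ∀ i, |(κ₁ i).re| ≤ σs ∧ |(κ₂ i).re| ≤ σs := fun i ↦ by
      rw [hκ₁re, hκ₂re, abs_of_pos (hσpos i)]; exact ⟨(hσlt i).le, (hσlt i).le⟩
    have him : ∀ i, (κ₁ i).im ≠ 0 ∧ (κ₂ i).im ≠ 0 := fun i ↦ by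
      rw [hκ₁im, hκ₂im]; exact ⟨(hγ₁pos i).ne', (hγ₂pos i).ne'⟩
    have h1 := abs_modelPsi_le_window (fun i ↦ ⟨(hm₁ i).le, (hm₂ i).le⟩) hre him hsumm.hasSum ht
    have h2 : 8 * Real.exp (σs * U) * ∑' i, (m₁ i / (κ₁ i).im ^ 2 + m₂ i / (κ₂ i).im ^ 2) ≤
        8 * Real.exp (σs * U) * (6 * (lam * ∑' i, α i)) :=
      mul_le_mul_of_nonneg_left htsum6 (by positivity)
    have hMQ2' : 36 * h ^ 2 * Real.exp (σs * U) * (∑' j, α j) / (π ^ 2 * ε) ≤ (M : ℝ) ^ 2 := by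
      rw [← hQ_def]; exact hMQ2
    rw [hlam] at h2
    exact h1.trans (h2.trans (footprint_budget hε hM0 hMQ2'))

/-! ## 20. The K-task kernel and the class form, unconditional -/

/-- **PRIME-WINDOW BLINDNESS, kernel (K-task K1 of line L53, PROVED).**  For every lattice step `h > 0`, width
`σ* > 0`, thin exponent `e > 0`, window half-width `U ≥ 0` and budget `ε > 0` there is a configuration satisfying
the twelve B26 clauses `ThinBlindClauses h σ* e` whose prime-window footprint on `[-U, U]` is `≤ ε`
(`PrimeWindowSmall U ε`).  RH-free; nothing here bears on the truth of RH. -/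
theorem primeWindowBlindModel_holds : PrimeWindowBlindModel := by
  intro h σs e U ε hh hσs he _hU hε
  have hc : (0 : ℝ) < 1 / ((⌈4 / e⌉₊ : ℕ) + 3 : ℝ) := by positivity
  obtain ⟨ι, m₁, m₂, κ₁, κ₂, H, hW⟩ := exists_tower_thin_blind_model_window U hh hσs hc he le_rfl hε
  exact ⟨⟨ι, m₁, m₂, κ₁, κ₂⟩, H, hW⟩

/-- **The class form, unconditional** (`PrimeWindowBlindnessClass.classCP_blind_to_tower` with its kernel
hypothesis discharged): every class-C_P criterion, at any step `h > 0`, window `U ≥ 0` and budget `ε > 0`, is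
satisfied by a NON-EMPTY off-line configuration with positive abscissae whose abscissa supremum is not attained —
primes `≤ e^U` read within `ε` are not load-bearing against capped thin towers.  Nothing here bears on the truth
of RH. -/
theorem classCP_blind_to_tower' {h U ε : ℝ} (hh : 0 < h) (hU : 0 ≤ U) (hε : 0 < ε) {P : Config → Prop}
    (hP : ClassCP h U ε P) :
    ∃ Z : Config, P Z ∧ Nonempty Z.ι ∧ (∀ i, 0 < (Z.κ₁ i).re) ∧ (∀ i, ∃ j, (Z.κ₁ i).re < (Z.κ₁ j).re) :=
  classCP_blind_to_tower primeWindowBlindModel_holds hh hU hε hP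

/-- **No class-C_P criterion implies RH-emptiness, unconditional** (`not_criterion_of_classCP` with its kernel
hypothesis discharged): no criterion generated by B26's clause list together with ε-honesty of the prime window
`[-U, U]` forces the off-line configuration to be empty, nor its abscissa supremum to be attained.  Nothing here
bears on the truth of RH. -/
theorem not_criterion_of_classCP' {h U ε : ℝ} (hh : 0 < h) (hU : 0 ≤ U) (hε : 0 < ε) {P : Config → Prop}
    (hP : ClassCP h U ε P) :
    ¬ (∀ Z : Config, P Z → IsEmpty Z.ι) ∧
    ¬ (∀ Z : Config, P Z → ∃ i, ∀ j, (Z.κ₁ j).re ≤ (Z.κ₁ i).re) :=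
  not_criterion_of_classCP primeWindowBlindModel_holds hh hU hε hP

end Summit.RiemannHypothesis.RiemannHypothesis.Theorems.Splittings.ScrewLatticeTower

end
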